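import Summits.QuantumFields.BalabanUV.Beta.GAN24.DirichletBoxRegularity
import Summits.QuantumFields.BalabanUV.T4Continuum.Support.VectorBlockTrialForm

/-!
# `BalabanUV.Beta.GAN24.DirichletBoxTrace` — binder row G-an2-4 / (CONV-C), road P2 PART II, module M-T: THE DISCRETE TRACE
# INEQUALITY for zero-extended lattice fields on BLOCK REGIONS — the boundary values of a field supported in a union of unit blocks are
# controlled by its Dirichlet energy and its INTERIOR diagonal second differences, with the gain `1/n` (unit b2b-balaban-gan24-p2, gen 22, v1)

HONEST FRAMING (cell contract, verbatim): «discharging `BetaPertH` makes Bałaban's UV stability UNCONDITIONAL — a real constructive-QFT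
result; it is NOT the continuum limit and NOT the Clay problem.»  SUPPLIER item «Δ1-BOX-SCALAR» under the T⁴-DAG sub-row
`T4-U1a.S-NE2-D1-DIRICHLET°` (holder: the t4-ne2-p1 lineage, wall `hinj`; owner ruling R20 (c), journal l.13903), memo
`HOME/b2b-balaban-gan24-p2/gen22/DIRICHLET-BOX-TWOLEVEL.md` step L4.  In the two-level pairing (modules M-P) the window of a BOUNDARY
face of the region sees the first exterior layer, where the second difference of the zero-extended Dirichlet solution is `−|c|²·(its
boundary value)`; that value is paired with the coarse boundary value.  THIS FILE bounds such boundary values («discrete normal traces»)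
along the UNIT-BLOCK lines of the torus `T = (ℤ/nM)^d` (lattice factor `c = n` = sites per unit block):

 * §1 **`tele_sq_le`** (pure telescoping): `‖g 0‖² ≤ (2/n)·(Σ_{j<n}‖g j‖² + Σ_{i<n−1}‖p i‖²)` whenever `‖g(i+1) − g i‖ ≤ ‖p i‖/n`;
   **`trace_sq_le_fwd`** / **`trace_sq_le_bwd`**: for EVERY lattice field `z`, site `y` and direction `μ`,
   `‖(∂_μz)(y − e_μ)‖² ≤ (2/n)·(Σ_{j<n}‖(∂_μz)(y − e_μ + je_μ)‖² + Σ_{i<n−1}‖(∂_μᴴ∂_μ z)(y + ie_μ)‖²)` and its mirror image (consecutive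
   bond differences of `∂_μz` are `∓(∂_μᴴ∂_μz)/n`).
 * §2 BLOCK REGIONS `blockReg n S = {x | blockOf x ∈ S}` (unions of unit blocks of `n^d` sites, `B5Blocks16.blockOf/bpt`): a region site
   whose backward (forward) neighbour is outside lies on the FIRST (LAST) `μ`-layer of its block, and the whole block line through it is
   inside (`n`-thickness); the FIRST-LAYER LINE TILING `Σ_{y : n ∣ y_μ} Σ_{i<n} F(y + ie_μ) = Σ_x F(x)` and its last-layer twin.
 * (companion file `DirichletBoxTraceSum`, §3: **`trace_fwd_sum_le`** / **`trace_bwd_sum_le`**: for `z` vanishing off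
   `Ω = blockReg n S`, `Σ_{y ∈ Ω, y−e_μ ∉ Ω} ‖n·z(y)‖² ≤ (2/n)·(‖∂_μz‖² + Σ_{x∈Ω}‖(∂_μᴴ∂_μz)(x)‖²)` and the same for `y + e_μ ∉ Ω` —
   the boundary values are small by `1/n` once the INTERIOR diagonal Hessian is controlled (module M-R on corner-free regions).)

ABSOLUTE RULE (cell, verbatim): «No internally-minted statement may enter as a cited fact. Every hypothesis is either kernel-proved in
this package or a verbatim quotation of a PUBLISHED theorem with page reference. The manuscript(s) under audit are NOT citable for
their own disputed steps — they are the thing under adjudication; programme-internal (2001/route/tribunal) claims are never citable.»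
[folklore] finite lattice calculus; nothing printed is a hypothesis.  NOT CLAIMED: NE2, (CONV-C) as a whole, `BetaPertH`, continuum, Clay;
«not in print; our proof attempt».  HONEST DEPENDENCY: continuum YM on T⁴ ⇐ BetaPertH ∧ nine spine estimates (0/9 proved); BetaPertH ⇐
(D1) ∧ (D4) ∧ CAP+tail; G-an2-4 gates asym, D1 and NE2/3/4.
-/

noncomputable section

open scoped BigOperators ComplexConjugate Matrix
open Finset

namespace Summit.QuantumFields.BalabanUV.Beta.GAN24.DirichletBoxTrace

open Literature.MathematicalPhysics.QuantumFieldTheory.Balaban1983to89.B5Prop11Plancherel (Tor fine unitVec)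
open Literature.MathematicalPhysics.QuantumFieldTheory.Balaban1983to89.B5Action121 (sdiff sdiff_mulVec)
open Literature.MathematicalPhysics.QuantumFieldTheory.Balaban1983to89.B5Prop11Lower (nsq nsq_nonneg)
open Literature.MathematicalPhysics.QuantumFieldTheory.Balaban1983to89.B5Block118 (tstep tstep_zero tstep_succ bpt iota up)
open Literature.MathematicalPhysics.QuantumFieldTheory.Balaban1983to89.B5Blocks16 (blockOf blockOf_bpt bpt_bijective bpt_val)
open Summit.QuantumFields.BalabanUV.Beta.GAN24.DirichletBoxRegularity (Pdir Pdir_mulVec)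
open Summit.QuantumFields.BalabanUV.T4Continuum.VectorBlockTrialForm (tstep_add)

variable {d : ℕ}

/-! ## §1 Telescoping and the pointwise trace inequalities -/

/-- **TELESCOPING TRACE INEQUALITY** (pure): if consecutive values differ by at most `‖p i‖/n`, then
`‖g 0‖² ≤ (2/n)·(Σ_{j<n}‖g j‖² + Σ_{i<n−1}‖p i‖²)`. [folklore] -/
theorem tele_sq_le {n : ℕ} (hn : 1 ≤ n) (g p : ℕ → ℂ) (h : ∀ i, i + 1 < n → ‖g (i + 1) - g i‖ ≤ ‖p i‖ / n) :
    ‖g 0‖ ^ 2 ≤ (2 / (n : ℝ)) * (∑ j ∈ range n, ‖g j‖ ^ 2 + ∑ i ∈ range (n - 1), ‖p i‖ ^ 2) := by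
  have hnpos : (0 : ℝ) < n := by exact_mod_cast hn
  set A := ∑ j ∈ range n, ‖g j‖ with hA
  set B := ∑ i ∈ range (n - 1), ‖p i‖ with hB
  have hA0 : 0 ≤ A := Finset.sum_nonneg fun _ _ => norm_nonneg _
  have hB0 : 0 ≤ B := Finset.sum_nonneg fun _ _ => norm_nonneg _
  -- for each `j < n`: `‖g 0‖ ≤ ‖g j‖ + B/n`
  have hj : ∀ j ∈ range n, ‖g 0‖ ≤ ‖g j‖ + B / n := by
    intro j hjn
    have hjn' := Finset.mem_range.mp hjn
    have htel : g j - g 0 = ∑ i ∈ range j, (g (i + 1) - g i) := (Finset.sum_range_sub g j).symm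
    have e : g 0 = g j - ∑ i ∈ range j, (g (i + 1) - g i) := by rw [← htel]; ring
    calc ‖g 0‖ = ‖g j - ∑ i ∈ range j, (g (i + 1) - g i)‖ := by rw [← e]
      _ ≤ ‖g j‖ + ‖∑ i ∈ range j, (g (i + 1) - g i)‖ := norm_sub_le _ _
      _ ≤ ‖g j‖ + ∑ i ∈ range j, ‖g (i + 1) - g i‖ := by gcongr; exact norm_sum_le _ _
      _ ≤ ‖g j‖ + ∑ i ∈ range j, ‖p i‖ / n := by
          gcongr with i hi
          exact h i (by have := Finset.mem_range.mp hi; omega)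
      _ ≤ ‖g j‖ + ∑ i ∈ range (n - 1), ‖p i‖ / n := by
          refine add_le_add le_rfl (Finset.sum_le_sum_of_subset_of_nonneg (Finset.range_subset_range.mpr (by omega)) ?_)
          intro i _ _; positivity
      _ = ‖g j‖ + B / n := by rw [hB, Finset.sum_div]
  -- sum over `j`: `n‖g 0‖ ≤ A + B`
  have hsum : (n : ℝ) * ‖g 0‖ ≤ A + B := by
    have h1 : ∑ j ∈ range n, ‖g 0‖ ≤ ∑ j ∈ range n, (‖g j‖ + B / n) := Finset.sum_le_sum hj
    rw [Finset.sum_const, Finset.card_range, nsmul_eq_mul, Finset.sum_add_distrib, Finset.sum_const, Finset.card_range,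
      nsmul_eq_mul] at h1
    have e : (n : ℝ) * (B / n) = B := by field_simp
    linarith [h1, e]
  -- Cauchy–Schwarz on `A` and `B`
  have hA2 : A ^ 2 ≤ n * ∑ j ∈ range n, ‖g j‖ ^ 2 := by
    have := sq_sum_le_card_mul_sum_sq (s := range n) (f := fun j => ‖g j‖)
    rwa [Finset.card_range] at this
  have hB2 : B ^ 2 ≤ n * ∑ i ∈ range (n - 1), ‖p i‖ ^ 2 := by
    have h1 := sq_sum_le_card_mul_sum_sq (s := range (n - 1)) (f := fun i => ‖p i‖)
    rw [Finset.card_range] at h1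
    have h2 : ((n - 1 : ℕ) : ℝ) ≤ n := by exact_mod_cast Nat.sub_le n 1
    exact h1.trans (mul_le_mul_of_nonneg_right h2 (Finset.sum_nonneg fun _ _ => sq_nonneg _))
  have hg0 : 0 ≤ ‖g 0‖ := norm_nonneg _
  have key : (n : ℝ) ^ 2 * ‖g 0‖ ^ 2 ≤ 2 * n * (∑ j ∈ range n, ‖g j‖ ^ 2 + ∑ i ∈ range (n - 1), ‖p i‖ ^ 2) := by
    calc (n : ℝ) ^ 2 * ‖g 0‖ ^ 2 = ((n : ℝ) * ‖g 0‖) ^ 2 := by ring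
      _ ≤ (A + B) ^ 2 := pow_le_pow_left₀ (by positivity) hsum 2
      _ ≤ 2 * A ^ 2 + 2 * B ^ 2 := by nlinarith [sq_nonneg (A - B)]
      _ ≤ 2 * n * (∑ j ∈ range n, ‖g j‖ ^ 2 + ∑ i ∈ range (n - 1), ‖p i‖ ^ 2) := by nlinarith [hA2, hB2]
  rw [div_mul_eq_mul_div, le_div_iff₀ hnpos]
  nlinarith [key]

section Torus

variable (n : ℕ) [NeZero n] (M : Fin d → ℕ) [hM : ∀ μ, NeZero (M μ)]

/-- consecutive bond values of `∂_μz` differ by `−(∂_μᴴ∂_μz)/n`: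
`(∂_μz)(x) − (∂_μz)(x − e_μ) = −(∂_μᴴ∂_μz)(x)/n`. [folklore] -/
theorem sdiff_sub_sdiff_eq (μ : Fin d) (z : Tor (fine n M) → ℂ) (x : Tor (fine n M)) :
    (sdiff (fine n M) (n : ℂ) μ *ᵥ z) x - (sdiff (fine n M) (n : ℂ) μ *ᵥ z) (x - unitVec (fine n M) μ)
      = -((Pdir (fine n M) (n : ℂ) μ *ᵥ z) x) / (n : ℂ) := by
  have hn : (n : ℂ) ≠ 0 := by exact_mod_cast NeZero.ne n
  rw [sdiff_mulVec, sdiff_mulVec, Pdir_mulVec, sub_add_cancel, Complex.conj_natCast]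
  field_simp
  ring

/-- **POINTWISE TRACE INEQUALITY, forward**: for EVERY `z`, `y`, `μ`,
`‖(∂_μz)(y − e_μ)‖² ≤ (2/n)·(Σ_{j<n}‖(∂_μz)(y − e_μ + j e_μ)‖² + Σ_{i<n−1}‖(∂_μᴴ∂_μz)(y + i e_μ)‖²)`. [folklore] -/
theorem trace_sq_le_fwd (hn : 1 ≤ n) (μ : Fin d) (z : Tor (fine n M) → ℂ) (y : Tor (fine n M)) :
    ‖(sdiff (fine n M) (n : ℂ) μ *ᵥ z) (y - unitVec (fine n M) μ)‖ ^ 2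
      ≤ (2 / (n : ℝ)) * (∑ j ∈ range n, ‖(sdiff (fine n M) (n : ℂ) μ *ᵥ z) (y - unitVec (fine n M) μ + tstep (fine n M) μ j)‖ ^ 2
          + ∑ i ∈ range (n - 1), ‖(Pdir (fine n M) (n : ℂ) μ *ᵥ z) (y + tstep (fine n M) μ i)‖ ^ 2) := by
  have hnR : (0 : ℝ) < n := by exact_mod_cast hn
  have h := tele_sq_le hn (fun j => (sdiff (fine n M) (n : ℂ) μ *ᵥ z) (y - unitVec (fine n M) μ + tstep (fine n M) μ j))
    (fun i => (Pdir (fine n M) (n : ℂ) μ *ᵥ z) (y + tstep (fine n M) μ i)) (fun i _ => by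
      have e1 : y - unitVec (fine n M) μ + tstep (fine n M) μ (i + 1) = y + tstep (fine n M) μ i := by
        rw [tstep_succ]; abel
      have e2 : y - unitVec (fine n M) μ + tstep (fine n M) μ i = (y + tstep (fine n M) μ i) - unitVec (fine n M) μ := by abel
      rw [e1, e2, sdiff_sub_sdiff_eq, norm_div, norm_neg, Complex.norm_natCast])
  simpa only [tstep_zero, add_zero] using h

/-- **POINTWISE TRACE INEQUALITY, backward**: for EVERY `z`, `y`, `μ`,
`‖(∂_μz)(y)‖² ≤ (2/n)·(Σ_{j<n}‖(∂_μz)(y − j e_μ)‖² + Σ_{i<n−1}‖(∂_μᴴ∂_μz)(y − i e_μ)‖²)`. [folklore] -/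
theorem trace_sq_le_bwd (hn : 1 ≤ n) (μ : Fin d) (z : Tor (fine n M) → ℂ) (y : Tor (fine n M)) :
    ‖(sdiff (fine n M) (n : ℂ) μ *ᵥ z) y‖ ^ 2
      ≤ (2 / (n : ℝ)) * (∑ j ∈ range n, ‖(sdiff (fine n M) (n : ℂ) μ *ᵥ z) (y - tstep (fine n M) μ j)‖ ^ 2
          + ∑ i ∈ range (n - 1), ‖(Pdir (fine n M) (n : ℂ) μ *ᵥ z) (y - tstep (fine n M) μ i)‖ ^ 2) := by
  have hnR : (0 : ℝ) < n := by exact_mod_cast hn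
  have h := tele_sq_le hn (fun j => (sdiff (fine n M) (n : ℂ) μ *ᵥ z) (y - tstep (fine n M) μ j))
    (fun i => (Pdir (fine n M) (n : ℂ) μ *ᵥ z) (y - tstep (fine n M) μ i)) (fun i _ => by
      have e1 : y - tstep (fine n M) μ (i + 1) = (y - tstep (fine n M) μ i) - unitVec (fine n M) μ := by
        rw [tstep_succ]; abel
      rw [e1, ← neg_sub, norm_neg, sdiff_sub_sdiff_eq, norm_div, norm_neg, Complex.norm_natCast])
  simpa only [tstep_zero, sub_zero] using h

/-! ## §2 Block regions, layers, and the first-layer line tiling -/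

/-- [shape] the BLOCK REGION generated by a set `S` of unit blocks: `{x | blockOf x ∈ S}`. [folklore] -/
def blockReg (S : Tor M → Prop) : Tor (fine n M) → Prop := fun x => S (blockOf n M x)

/-- membership in a block region is decidable. [folklore] -/
instance decBlockReg (S : Tor M → Prop) [DecidablePred S] : DecidablePred (blockReg n M S) :=
  fun x => inferInstanceAs (Decidable (S (blockOf n M x)))

omit [NeZero n] hM in
/-- moving along `μ` inside a block from its first layer: `iota j + s·e_μ = iota (j[μ ↦ s])` when `j_μ = 0`. [folklore] -/
theorem iota_add_tstep_eq (μ : Fin d) {j : Fin d → Fin n} (hj : (j μ : ℕ) = 0) (s : Fin n) :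
    iota n M j + tstep (fine n M) μ (s : ℕ) = iota n M (Function.update j μ s) := by
  funext ν
  by_cases h : ν = μ
  · subst h; simp [iota, tstep, hj]
  · simp [iota, tstep, h]

omit [NeZero n] in
/-- the `μ`-offset of a block point: `(bpt b j)_μ mod n = j_μ`. [folklore] -/
theorem bpt_val_mod (b : Tor M) (j : Fin d → Fin n) (μ : Fin d) : ((bpt n M b j) μ).val % n = (j μ : ℕ) := by
  rw [bpt_val, Nat.mul_add_mod, Nat.mod_eq_of_lt (j μ).isLt]

omit [NeZero n] in
/-- first-layer characterisation: `n ∣ (bpt b j)_μ ↔ j_μ = 0`. [folklore] -/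
theorem dvd_bpt_iff (b : Tor M) (j : Fin d → Fin n) (μ : Fin d) : n ∣ ((bpt n M b j) μ).val ↔ (j μ : ℕ) = 0 := by
  rw [Nat.dvd_iff_mod_eq_zero, bpt_val_mod]

/-- last-layer characterisation: `n ∣ (bpt b j)_μ + 1 ↔ j_μ = n − 1`. [folklore] -/
theorem dvd_bpt_succ_iff (b : Tor M) (j : Fin d → Fin n) (μ : Fin d) : n ∣ ((bpt n M b j) μ).val + 1 ↔ (j μ : ℕ) = n - 1 := by
  have hj := (j μ).isLt
  rw [Nat.dvd_iff_mod_eq_zero, Nat.add_mod, bpt_val_mod]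
  constructor
  · intro h
    by_contra hne
    have hlt : (j μ : ℕ) + 1 < n := by omega
    rw [Nat.mod_eq_of_lt (show 1 < n by omega), Nat.mod_eq_of_lt hlt] at h
    omega
  · intro h
    rcases Nat.lt_or_ge 1 n with h1 | h1
    · rw [Nat.mod_eq_of_lt h1, h, Nat.sub_add_cancel (by omega), Nat.mod_self]
    · have : n = 1 := by have := NeZero.ne n; omega
      subst this; simp

/-- every site is a block point (surjectivity of the tiling). [folklore] -/
theorem exists_bpt_eq (x : Tor (fine n M)) : ∃ (b : Tor M) (j : Fin d → Fin n), bpt n M b j = x := by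
  obtain ⟨⟨b, j⟩, h⟩ := (bpt_bijective n M).2 x
  exact ⟨b, j, h⟩

omit hM in
/-- a block point moved within its block along `μ`: `bpt b j[μ↦0] + s·e_μ = bpt b (j[μ ↦ s])`. [folklore] -/
theorem bpt_update_add_tstep (b : Tor M) (j : Fin d → Fin n) (μ : Fin d) (s : Fin n) :
    bpt n M b (Function.update j μ 0) + tstep (fine n M) μ (s : ℕ) = bpt n M b (Function.update j μ s) := by
  rw [bpt, bpt, add_assoc, iota_add_tstep_eq n M μ (by simp) s]
  simp

omit hM in
/-- in particular `bpt b j = bpt b j[μ↦0] + j_μ·e_μ`. [folklore] -/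
theorem bpt_eq_update_add (b : Tor M) (j : Fin d → Fin n) (μ : Fin d) :
    bpt n M b j = bpt n M b (Function.update j μ 0) + tstep (fine n M) μ (j μ : ℕ) := by
  rw [bpt_update_add_tstep n M b j μ (j μ)]
  simp

section Region

variable (S : Tor M → Prop)

/-- **a region site whose backward neighbour is outside lies on the first layer.** [folklore] -/
theorem dvd_of_boundary_fwd {μ : Fin d} {y : Tor (fine n M)} (hy : blockReg n M S y)
    (hy' : ¬ blockReg n M S (y - unitVec (fine n M) μ)) : n ∣ (y μ).val := by
  obtain ⟨b, j, rfl⟩ := exists_bpt_eq n M y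
  rw [dvd_bpt_iff]
  by_contra hne
  apply hy'
  -- `bpt b j − e_μ = bpt b (j[μ ↦ j_μ − 1])`, same block
  have hj := (j μ).isLt
  set s : Fin n := ⟨(j μ : ℕ) - 1, by omega⟩ with hs
  have hs1 : (j μ : ℕ) = (s : ℕ) + 1 := by rw [hs]; simp only; omega
  have e : bpt n M b j - unitVec (fine n M) μ = bpt n M b (Function.update j μ s) := by
    rw [← bpt_update_add_tstep n M b j μ s, bpt_eq_update_add n M b j μ, hs1, tstep_succ]
    abel
  rw [e]
  show S (blockOf n M (bpt n M b (Function.update j μ s)))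
  rw [blockOf_bpt]
  have : S (blockOf n M (bpt n M b j)) := hy
  rwa [blockOf_bpt] at this

/-- **a region site whose forward neighbour is outside lies on the last layer.** [folklore] -/
theorem dvd_succ_of_boundary_bwd {μ : Fin d} {y : Tor (fine n M)} (hy : blockReg n M S y)
    (hy' : ¬ blockReg n M S (y + unitVec (fine n M) μ)) : n ∣ (y μ).val + 1 := by
  obtain ⟨b, j, rfl⟩ := exists_bpt_eq n M y
  rw [dvd_bpt_succ_iff]
  by_contra hne
  apply hy'
  have hj := (j μ).isLt
  set s : Fin n := ⟨(j μ : ℕ) + 1, by omega⟩ with hs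
  have hs1 : (s : ℕ) = (j μ : ℕ) + 1 := by rw [hs]
  have e : bpt n M b j + unitVec (fine n M) μ = bpt n M b (Function.update j μ s) := by
    rw [← bpt_update_add_tstep n M b j μ s, bpt_eq_update_add n M b j μ, hs1, tstep_succ]
    abel
  rw [e]
  show S (blockOf n M (bpt n M b (Function.update j μ s)))
  rw [blockOf_bpt]
  have : S (blockOf n M (bpt n M b j)) := hy
  rwa [blockOf_bpt] at this

/-- **thickness**: from a first-layer region site the next `n − 1` sites along `+e_μ` are in the region. [folklore] -/
theorem blockReg_add_tstep {μ : Fin d} {y : Tor (fine n M)} (hy : blockReg n M S y) (hdvd : n ∣ (y μ).val) {i : ℕ} (hi : i < n) :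
    blockReg n M S (y + tstep (fine n M) μ i) := by
  obtain ⟨b, j, rfl⟩ := exists_bpt_eq n M y
  have hj0 : (j μ : ℕ) = 0 := (dvd_bpt_iff n M b j μ).mp hdvd
  have hj : Function.update j μ 0 = j := by
    funext ν; by_cases h : ν = μ
    · subst h; apply Fin.ext; simp [hj0]
    · simp [h]
  have e : bpt n M b j + tstep (fine n M) μ i = bpt n M b (Function.update j μ ⟨i, hi⟩) := by
    rw [← bpt_update_add_tstep n M b j μ ⟨i, hi⟩, hj]
  rw [e]
  show S (blockOf n M _)
  rw [blockOf_bpt]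
  have : S (blockOf n M (bpt n M b j)) := hy
  rwa [blockOf_bpt] at this

/-- a last-layer site, pulled back `n − 1` steps, lands on the first layer of its own block. [folklore] -/
theorem firstLayer_of_lastLayer {μ : Fin d} {y : Tor (fine n M)} (hdvd : n ∣ (y μ).val + 1) :
    n ∣ ((y - tstep (fine n M) μ (n - 1)) μ).val ∧ blockOf n M (y - tstep (fine n M) μ (n - 1)) = blockOf n M y := by
  obtain ⟨b, j, rfl⟩ := exists_bpt_eq n M y
  have hjl : (j μ : ℕ) = n - 1 := (dvd_bpt_succ_iff n M b j μ).mp hdvd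
  have e : bpt n M b j - tstep (fine n M) μ (n - 1) = bpt n M b (Function.update j μ 0) := by
    rw [sub_eq_iff_eq_add, ← hjl, ← bpt_eq_update_add n M b j μ]
  rw [e, dvd_bpt_iff, blockOf_bpt, blockOf_bpt]
  exact ⟨by simp, rfl⟩

/-- **thickness, backward**: from a last-layer region site the previous `n − 1` sites along `−e_μ` are in the region, and they
are the forward line from the first-layer site `y − (n−1)e_μ`. [folklore] -/
theorem blockReg_sub_tstep {μ : Fin d} {y : Tor (fine n M)} (hy : blockReg n M S y) (hdvd : n ∣ (y μ).val + 1) {i : ℕ} (hi : i < n) :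
    blockReg n M S (y - tstep (fine n M) μ i) := by
  obtain ⟨h1, h2⟩ := firstLayer_of_lastLayer n M hdvd
  have hy0 : blockReg n M S (y - tstep (fine n M) μ (n - 1)) := by
    show S (blockOf n M _); rw [h2]; exact hy
  have e : y - tstep (fine n M) μ i = (y - tstep (fine n M) μ (n - 1)) + tstep (fine n M) μ (n - 1 - i) := by
    rw [sub_add, sub_right_inj, eq_sub_iff_add_eq, ← tstep_add]
    congr 1; omega
  rw [e]
  exact blockReg_add_tstep n M S hy0 h1 (by omega)

end Region

/-- sums over the torus, tiled by unit blocks (any additive target). [folklore] -/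
theorem sum_eq_sum_bpt {β : Type*} [AddCommMonoid β] (F : Tor (fine n M) → β) :
    ∑ x, F x = ∑ b : Tor M, ∑ j : Fin d → Fin n, F (bpt n M b j) := by
  rw [← (bpt_bijective n M).sum_comp F, Fintype.sum_prod_type]

/-- fibring the offsets over their `μ`-component: `Σ_j G(j) = Σ_{s<n} Σ_{j: j_μ=0} G(j[μ ↦ s])`. [folklore] -/
theorem sum_update_layers' {β : Type*} [AddCommMonoid β] (μ : Fin d) (G : (Fin d → Fin n) → β) :
    ∑ j : Fin d → Fin n, G j
      = ∑ s : Fin n, ∑ j ∈ univ.filter (fun j : Fin d → Fin n => (j μ : ℕ) = 0), G (Function.update j μ s) := by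
  rw [← Finset.sum_fiberwise_of_maps_to (s := (univ : Finset (Fin d → Fin n))) (t := (univ : Finset (Fin n)))
    (g := fun j => j μ) (fun _ _ => Finset.mem_univ _)]
  refine Finset.sum_congr rfl fun s _ => ?_
  refine Finset.sum_nbij' (fun j => Function.update j μ 0) (fun j => Function.update j μ s) ?_ ?_ ?_ ?_ ?_
  · intro j hj; simp
  · intro j hj; simp
  · intro j hj
    have hj' : j μ = s := by simpa using hj
    funext ν; by_cases h : ν = μ
    · subst h; simp [hj']
    · simp [h]
  · intro j hj
    have hj' : (j μ : ℕ) = 0 := by simpa using hj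
    funext ν; by_cases h : ν = μ
    · subst h; apply Fin.ext; simp [hj']
    · simp [h]
  · intro j hj
    have hj' : j μ = s := by simpa using hj
    congr 1; funext ν; by_cases h : ν = μ
    · subst h; simp [hj']
    · simp [h]

/-- **FIRST-LAYER LINE TILING**: `Σ_{y : n ∣ y_μ} Σ_{i<n} F(y + i e_μ) = Σ_x F(x)`. [folklore] -/
theorem sum_firstLayer_lines {β : Type*} [AddCommMonoid β] (μ : Fin d) (F : Tor (fine n M) → β) :
    ∑ y ∈ univ.filter (fun y : Tor (fine n M) => n ∣ (y μ).val), ∑ i ∈ range n, F (y + tstep (fine n M) μ i) = ∑ x, F x := by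
  symm
  rw [sum_eq_sum_bpt n M F]
  have hR : ∑ y ∈ univ.filter (fun y : Tor (fine n M) => n ∣ (y μ).val), ∑ i ∈ range n, F (y + tstep (fine n M) μ i)
      = ∑ b : Tor M, ∑ j ∈ univ.filter (fun j : Fin d → Fin n => (j μ : ℕ) = 0),
          ∑ i ∈ range n, F (bpt n M b j + tstep (fine n M) μ i) := by
    rw [Finset.sum_filter, sum_eq_sum_bpt n M]
    refine Finset.sum_congr rfl fun b _ => ?_
    rw [Finset.sum_filter]
    refine Finset.sum_congr rfl fun j _ => ?_
    simp only [dvd_bpt_iff]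
  rw [hR]
  refine Finset.sum_congr rfl fun b _ => ?_
  rw [sum_update_layers' n μ, Finset.sum_comm]
  refine Finset.sum_congr rfl fun j hj => ?_
  rw [← Fin.sum_univ_eq_sum_range]
  refine Finset.sum_congr rfl fun s _ => ?_
  have hj' : (j μ : ℕ) = 0 := by simpa using hj
  have hju : Function.update j μ 0 = j := by
    funext ν; by_cases h : ν = μ
    · subst h; apply Fin.ext; simp [hj']
    · simp [h]
  rw [← bpt_update_add_tstep n M b j μ s, hju]

/-- a sum over first-layer sites of line sums of a nonnegative density is at most the total; the same for any SUBSET of the first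
layer. [folklore] -/
theorem sum_lines_le_of_subset (μ : Fin d) {B : Finset (Tor (fine n M))}
    (hB : B ⊆ univ.filter (fun y : Tor (fine n M) => n ∣ (y μ).val)) {H : Tor (fine n M) → ℝ} (hH : ∀ x, 0 ≤ H x) :
    ∑ y ∈ B, ∑ i ∈ range n, H (y + tstep (fine n M) μ i) ≤ ∑ x, H x := by
  rw [← sum_firstLayer_lines n M μ H]
  exact Finset.sum_le_sum_of_subset_of_nonneg hB (fun y _ _ => Finset.sum_nonneg fun i _ => hH _)

end Torus

end Summit.QuantumFields.BalabanUV.Beta.GAN24.DirichletBoxTrace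

end
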